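import Literature.AnabelianGeometry.EtaleTheta.ThetaFrobenioidInducedBaseSquare
import Literature.AnabelianGeometry.EtaleTheta.TemperedFrobenioidRebase
import Literature.AnabelianGeometry.EtaleTheta.TemperedFrobenioidRestrict
import Literature.AnabelianGeometry.EtaleTheta.TemperedFrobenioidOfRankOneBase
import Literature.AnabelianGeometry.EtaleTheta.Discharge.Sec3Example39Base
import Literature.AnabelianGeometry.EtaleTheta.Discharge.Sec3CuspidallyPureOfRankOneObject

/-!
# [EtTh] Example 3.9 (iv) «`Φ_α^ell` is cuspidally pure» (F-0615) PRODUCED at the Example 3.9 datum over a GENUINE base `D_W = B^temp(Π_W)⁰` (pp. 309–311 / PDF pp. 83–85; Def. 3.6 (v) p. 304 / PDF p. 78)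

S. Mochizuki, *The étale theta function and its Frobenioid-theoretic manifestations*, Publ. RIMS **45** (2009)
[cite: MochizukiEtTh2009, Ex 3.9 (iv) p.311 (PDF p.85); Def 3.6 (v) p.304 (PDF p.78)]: Example 3.9 (iv) «`D_α := (D_W)_B[α]` …
`Φ_α^ell := Φ_W^ell|_{D_α}` … it follows immediately from the above discussion that … `Φ_α^ell` is … cuspidally pure … and
gives rise to a tempered Frobenioid»; Def. 3.6 (v): (a) every non-cuspidal primary element is dominated by a base-field-theoretic
one, (b) `Prime(Φ(A)) = Prime^ncsp ⊔ Prime^csp`.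

PROOF-ONLY companion (no `def`, no instance, no new named fact; nothing landed is edited or restated).  abc-iut cell, layer L2,
seat abc-iut-w6-d047 (gen 4), abc-iut-L2-lead R858 PRIMARY «EX39-CUSP-PURE@GENUINE» (VNEXT add. 9): FACT-LIST row **F-0615**
`Example39Data.Example39_iv_cuspidallyPure E α h := (E.thetaFrobenioid α h).IsCuspidallyPure` — a `parametrised` predicate on the
DATA-ONLY interface `E : Example39Data V D_W T_W` whose universal closure is REFUTED (abc-iut-f-144
`not_forall_example39_iv_cuspidallyPure`) and whose only producer so far lives at a one-object TOY (`Toy.example39_iv_cuspidallyPure_toy`);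
abc-iut-w6-d050's census 00:41Z: «missing producer shape = `E.Example39_iv_cuspidallyPure α h` at the Ex 3.9 (i)–(iii) datum over a
genuine base».

CENSUS (what the tree holds, all consumed BY NAME): abc-iut-w6-d059's constructor `Example39Data.ofInducedSquare` (GENUINE (i): four
connected temperoids `B^temp(Π)⁰` with the induction functors of a commutative square of open continuous homomorphisms and the PROVED
1-commutativity; (ii)/(iii) = caller's inputs); abc-iut-L2-t4's `RealifiedDivisorMonoids.precomp` (Def. 3.6 (i) data whiskered along a
functor — so that a tempered Frobenioid `C` over `D_W` with structure functor `C.base : D_W → D₀` supplies (iii) := `C.Φ` for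
`T_W := T.precomp C.base`, exactly print's «`Φ_W` … the monoid on `D_W` given by … `Φ₀`»); abc-iut-L2-t9's `Example39Data.isConnected_Dα` /
`isTotallyEpimorphic_Dα` / `isOfFSMType_Dα` ([FrdI] §0 slice inheritance); abc-iut-L2-t3's `SubMonoidOn.isMonoidOn_restrict_toFunctor` /
`treeCatVocab_isDivisorialOn` (the engine of `TemperedFrobenioid.restrict`); abc-iut-f-128's `TemperedFrobenioid.IsCuspidallyPure.restrict`
idea (Def. 3.6 (v) is OBJECTWISE) and models (`…isCuspidallyPure_ofRankOneObjectConnectedPart`); [FrdII] Ex. 1.3 (i)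
(`connectedPart_isOfFSMType` / `connectedPart_isTotallyEpimorphic`).

WHAT IS PROVED.
* §1 — for EVERY tempered Frobenioid `C` over a genuine base `D_W = ConnectedPart (BTemp Π_W)` in the tree category vocabulary, every
  (i)-square and (ii)-package admissible for `ofInducedSquare`, and every arrow `α : A ⟶ B` of `D_W`, writing `E` for the Example 3.9 datum
  `ofInducedSquare … (T.precomp C.base) … (Φ_W^ell := C.Φ) …` (inputs: `Φ` perfect, non-dilating — the two (iii)-clauses a
  `TemperedFrobenioid` does not carry):
  `Example39Data.frobenioidHyp_ofInducedSquare_ofTempered` — the Def. 3.6 (ii) hypothesis record `E.FrobenioidHyp α VD` at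
  `VD := treeCatVocab (D_α)` is INHABITED (all five clauses THEOREMS: `D_α` connected / totally epimorphic — L2-t9; `Φ_α^ell` divisorial —
  restriction of a divisorial monoid along `D_α → D_W` from an FSM-type slice; (a) monoprime `Φ^{bs-fld}`, (b) non-zero constants — read at
  `toDW α X` from `C`);
  **`Example39Data.example39_iv_cuspidallyPure_ofInducedSquare_ofTempered`** — F-0615 at that datum ⟸ `C.IsCuspidallyPure` (Def. 3.6 (v)
  is objectwise in `(Φ(A) ⊆ Φ₀^ℝ(Y_A), ncsp, csp, ℝ·Φ₀^cnst)`, print's «it follows immediately»).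
* §2 — the MODEL OF RECORD: abc-iut-w5-d179 / abc-iut-f-128's rank-one engine `TemperedFrobenioid.ofRankOneObjectConnectedPart P hpf R S Π`
  (every Def. 3.3 (iii) datum `dm` with a rank-one object `P`, every topological group `Π`; covers the Kummer–Tate / coset-Tate /
  one-component models): its `Φ` is PERFECT (`isPerfect_Φ_ofRankOneObjectConnectedPart`, image of a perfection) and NON-DILATING along every
  endomorphism (`isNonDilating_pull_ofRankOneObjectConnectedPart`: the structure functor is constant, so every pull-back is the identity),
  and it is cuspidally pure (f-128) — hence **`example39_iv_cuspidallyPure_ofRankOneObjectConnectedPart`**: F-0615 HOLDS, with NO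
  hypothesis beyond the construction data, at the Example 3.9 datum over `B^temp(Π)⁰` built from ANY admissible (i)-square / (ii)-package
  and (iii) := the rank-one engine's `Φ`.
HONEST LABEL: (i) genuine (or the caller's), (ii) the caller's (e.g. degenerate `D^ell := D`), (iii) := a CONSTRUCTED divisor monoid of record
(rank one at the model: one Galois orbit of prime log-divisors, so Def. 3.6 (v)(b) is one-sided there by construction — f-128's honest
note); this is an INSTANCE of the refuted-closure row at print's carrier SHAPE (genuine `B^temp(Π)⁰` base, slice `D_α`, restricted
`Φ_α^ell`), not the tempered Frobenioid of an actual Tate curve; nothing here bears on [IUTchIII] Cor. 3.12; typed ≠ proved; no side taken.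
[claim: MochizukiEtTh2009, status: refereed pre-IUT]
-/

noncomputable section

namespace Literature.AnabelianGeometry.EtaleTheta

open CategoryTheory Opposite Literature.AlgebraicGeometry.Frobenioids Literature.AlgebraicGeometry.Frobenioids.QuasiTemperoid
  Literature.AnabelianGeometry.SemiGraphs Literature.AlgebraicGeometry.Frobenioids.QuasiTemperoid.BTempConnected

universe w u u₀ v₀

namespace Example39Data

/-! ### §1. F-0615 at the Example 3.9 datum over `B^temp(Π_W)⁰` built from ANY cuspidally pure tempered Frobenioid -/

section OfTempered

variable {GU GX GY GW : Type u} [Group GU] [TopologicalSpace GU]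
  [Group GX] [TopologicalSpace GX] [IsTopologicalGroup GX]
  [Group GY] [TopologicalSpace GY] [IsTopologicalGroup GY]
  [Group GW] [TopologicalSpace GW] [IsTopologicalGroup GW]
  (iUX : GU →* GX) (iUY : GU →* GY) (iXW : GX →* GW) (iYW : GY →* GW)
  (hUX : IsOpenMap iUX) (hUY : IsOpenMap iUY) (hXW : IsOpenMap iXW) (hYW : IsOpenMap iYW)
  (cUX : Continuous iUX) (cUY : Continuous iUY) (cXW : Continuous iXW) (cYW : Continuous iYW)
  (hQX : ∀ V : Subgroup GX, IsOpen (V : Set GX) → Countable (GX ⧸ V))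
  (hQY : ∀ V : Subgroup GY, IsOpen (V : Set GY) → Countable (GY ⧸ V))
  (hQW : ∀ V : Subgroup GW, IsOpen (V : Set GW) → Countable (GW ⧸ V))
  (hsq : iXW.comp iUX = iYW.comp iUY)
  (ellY : ObjectProperty (ConnectedPart (BTemp GY)))
  (toEllY : ConnectedPart (BTemp GY) ⥤ ellY.FullSubcategory) (adjY : toEllY ⊣ ellY.ι)
  (ellW : ObjectProperty (ConnectedPart (BTemp GW)))
  (toEllW : ConnectedPart (BTemp GW) ⥤ ellW.FullSubcategory) (adjW : toEllW ⊣ ellW.ι)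
  {D₀ : Type u₀} [Category.{v₀} D₀] {V : FrdIMonoidStub.{w}} {T : RealifiedDivisorMonoids (D₀ := D₀) V}
  {IsRational IsStrictlyRational : ((ConnectedPart (BTemp GW))ᵒᵖ ⥤ CommMonCat.{w}) → Prop}
  (C : TemperedFrobenioid T (ConnectedPart (BTemp GW)) (treeCatVocab (ConnectedPart (BTemp GW)) IsRational IsStrictlyRational))
  (hperf : ∀ A, IsPerfect (C.Φ.carrier A))
  (hnd : ∀ (A : (ConnectedPart (BTemp GW))ᵒᵖ) (f : A ⟶ A), V.IsNonDilating (C.Φ.carrier A) (C.Φ.pull f))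
  {A B : ConnectedPart (BTemp GW)} (α : A ⟶ B)
  (IsRational' IsStrictlyRational' : ((Dα α)ᵒᵖ ⥤ CommMonCat.{w}) → Prop)

/-- **The Def. 3.6 (ii) hypothesis record `FrobenioidHyp` of Example 3.9 (iv) is INHABITED at the genuine-base datum built from a tempered
Frobenioid `C` over `D_W = B^temp(Π_W)⁰`** ((iii) := `C.Φ` over the whiskered Def. 3.6 (i) data `T.precomp C.base`): `D_α` connected and
totally epimorphic (abc-iut-L2-t9), `Φ_α^ell = Φ|_{D_α}` a divisorial monoid on `D_α` (a slice of an FSM-type category is of FSM-type, so the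
restriction engine of `TemperedFrobenioid.restrict` applies), (a)/(b) read from `C` at the object `D_α → D_W`.
[cite: MochizukiEtTh2009, Ex 3.9 (iv) p.311 (PDF p.85); Def 3.6 (ii) p.303 (PDF p.77)] -/
theorem frobenioidHyp_ofInducedSquare_ofTempered :
    (ofInducedSquare iUX iUY iXW iYW hUX hUY hXW hYW cUX cUY cXW cYW hQX hQY hQW hsq V (T.precomp C.base) ellY toEllY adjY ellW
      toEllW adjW C.Φ hperf C.isGroupSaturated C.isPerfFactorial hnd).FrobenioidHyp α
      (treeCatVocab (Dα α) IsRational' IsStrictlyRational') :=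
  frobenioidHyp_of α _ connectedPart_isTotallyEpimorphic _
    ((treeCatVocab_isDivisorialOn (Dα α) IsRational' IsStrictlyRational' _).mpr
      ⟨C.Φ.isMonoidOn_restrict_toFunctor (toDW α)
          ((treeCatVocab_isDivisorialOn _ IsRational IsStrictlyRational _).mp C.isDivisorialOn).1
          (fun f hf => by
            haveI := (isOfFSMType_Dα α connectedPart_isOfFSMType).isIso_of_isFSM f hf
            exact IsFSM.of_isIso ((toDW α).map f)),
        fun X => ((treeCatVocab_isDivisorialOn _ IsRational IsStrictlyRational _).mp C.isDivisorialOn).2 ((toDW α).obj X)⟩)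
    (fun X => C.isMonoprime_bsFld ((toDW α).op.obj X))
    (fun X => C.exists_FΛ_div_ne ((toDW α).op.obj X))

/-- **Example 3.9 (iv) «`Φ_α^ell` is cuspidally pure» (FACT row F-0615) at the genuine-base datum, ⟸ `C` cuspidally pure** — Def. 3.6 (v) is
objectwise in `(Φ(A) ⊆ Φ₀^ℝ(Y_A), ncsp, csp, ℝ·Φ₀^cnst at Y_A)`, and every clause at `X ∈ Ob(D_α)` is literally the clause of `C` at the image
of `X` in `D_W` (print: «it follows immediately from the above discussion»). [cite: MochizukiEtTh2009, Ex 3.9 (iv) p.311 (PDF p.85); Def 3.6 (v) p.304 (PDF p.78)] -/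
theorem example39_iv_cuspidallyPure_ofInducedSquare_ofTempered (hcp : C.IsCuspidallyPure) :
    (ofInducedSquare iUX iUY iXW iYW hUX hUY hXW hYW cUX cUY cXW cYW hQX hQY hQW hsq V (T.precomp C.base) ellY toEllY adjY ellW
      toEllW adjW C.Φ hperf C.isGroupSaturated C.isPerfFactorial hnd).Example39_iv_cuspidallyPure α
      (frobenioidHyp_ofInducedSquare_ofTempered iUX iUY iXW iYW hUX hUY hXW hYW cUX cUY cXW cYW hQX hQY hQW hsq ellY toEllY adjY
        ellW toEllW adjW C hperf hnd α IsRational' IsStrictlyRational') where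
  exists_bsFld_dvd X x hx hnc := by
    obtain ⟨y, hy, hxy⟩ := hcp.exists_bsFld_dvd ((toDW α).op.obj X) x hx hnc
    exact ⟨y, hy, hxy⟩
  ncsp_or_csp X 𝔭 := hcp.ncsp_or_csp ((toDW α).op.obj X) 𝔭
  not_ncsp_and_csp X 𝔭 := hcp.not_ncsp_and_csp ((toDW α).op.obj X) 𝔭

end OfTempered

/-! ### §2. At the MODEL OF RECORD: the rank-one engine over `B^temp(Π)⁰` — F-0615 with no hypothesis beyond the construction data -/

end Example39Data

namespace TemperedFrobenioid

section RankOneModel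

variable {D₀ : Type u₀} [Category.{v₀} D₀] {dm : DivisorMonoids.{u₀, v₀, 0} D₀} (P : dm.RankOneObject)
  (hpf : ∀ Y : D₀ᵒᵖ, IsPerfFactorialCof (dm.Φ₀.obj Y)) (R S : ((Discrete PUnit.{1})ᵒᵖ ⥤ CommMonCat.{0}) → Prop)
  (Γ : Type) [Group Γ] [TopologicalSpace Γ] (R' S' : ((ConnectedPart (BTemp Γ))ᵒᵖ ⥤ CommMonCat.{0}) → Prop)

/-- **`Φ` of the rank-one engine over `B^temp(Π)⁰` is PERFECT** (it is `im(Φ₀(Y₀)^pf → Φ₀(Y₀)^rlf)`, the bijective image of a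
perfection — the `hperf` slot of `Example39Data`; abc-iut-w5-d179's `ofDiagonalBase_isPerfect` pattern).
[cite: MochizukiEtTh2009, Ex 3.9 (iii) p.310 (PDF p.84); Def 4.1 p.312 (PDF p.86)] -/
theorem isPerfect_Φ_ofRankOneObjectConnectedPart (A : (ConnectedPart (BTemp Γ))ᵒᵖ) :
    IsPerfect ((ofRankOneObjectConnectedPart P hpf R S Γ R' S').Φ.carrier A) :=
  IsPerfect.of_mulEquiv (MulEquiv.ofBijective _ (PfImageWeak.mrangeRestrict_toRealification_bijective (hpf (op P.Y₀)).weak))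
    isPerfect_perfection

/-- **Every pull-back of `Φ` of the rank-one engine over `B^temp(Π)⁰` is the IDENTITY**: the structure functor `B^temp(Π)⁰ → {pt} → D₀` is
constant at `Y₀`, so `Φ(f) = Φ₀^ℝ(𝟙_{Y₀})|_Φ = id` for every arrow `f` of `B^temp(Π)⁰`. [cite: MochizukiEtTh2009, Def 3.6 (i) p.302 (PDF p.76)] -/
theorem pull_apply_ofRankOneObjectConnectedPart {A : (ConnectedPart (BTemp Γ))ᵒᵖ} (f : A ⟶ A)
    (x : (ofRankOneObjectConnectedPart P hpf R S Γ R' S').Φ.carrier A) :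
    (ofRankOneObjectConnectedPart P hpf R S Γ R' S').Φ.pull f x = x := by
  apply Subtype.ext
  rw [SubMonoidOn.coe_pull]
  change ((RealifiedDivisorMonoids.ofRlfZWeak dm hpf).ΦR.map (𝟙 (op P.Y₀))).hom x.1 = x.1
  rw [CategoryTheory.Functor.map_id]
  rfl

/-- **`Φ` of the rank-one engine over `B^temp(Π)⁰` is NON-DILATING along every endomorphism** ([FrdI] Def. 1.1 (i); the `hnd` slot of
`Example39Data` / the «non-dilating» clause of Example 3.9 (iii) and Def. 3.6 (ii)): an identity map is non-dilating
(abc-iut-w5-d179's `isNonDilating_of_apply_eq`). [cite: MochizukiEtTh2009, Ex 3.9 (iii) p.310 (PDF p.84)] -/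
theorem isNonDilating_pull_ofRankOneObjectConnectedPart (A : (ConnectedPart (BTemp Γ))ᵒᵖ) (f : A ⟶ A) :
    treeMonoidVocabWeak.{0}.IsNonDilating ((ofRankOneObjectConnectedPart P hpf R S Γ R' S').Φ.carrier A)
      ((ofRankOneObjectConnectedPart P hpf R S Γ R' S').Φ.pull f) :=
  isNonDilating_of_apply_eq _ fun x => pull_apply_ofRankOneObjectConnectedPart P hpf R S Γ R' S' f x

variable [IsTopologicalGroup Γ] {GU GX GY : Type} [Group GU] [TopologicalSpace GU]
  [Group GX] [TopologicalSpace GX] [IsTopologicalGroup GX] [Group GY] [TopologicalSpace GY] [IsTopologicalGroup GY]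
  (iUX : GU →* GX) (iUY : GU →* GY) (iXW : GX →* Γ) (iYW : GY →* Γ)
  (hUX : IsOpenMap iUX) (hUY : IsOpenMap iUY) (hXW : IsOpenMap iXW) (hYW : IsOpenMap iYW)
  (cUX : Continuous iUX) (cUY : Continuous iUY) (cXW : Continuous iXW) (cYW : Continuous iYW)
  (hQX : ∀ V : Subgroup GX, IsOpen (V : Set GX) → Countable (GX ⧸ V))
  (hQY : ∀ V : Subgroup GY, IsOpen (V : Set GY) → Countable (GY ⧸ V))
  (hQW : ∀ V : Subgroup Γ, IsOpen (V : Set Γ) → Countable (Γ ⧸ V))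
  (hsq : iXW.comp iUX = iYW.comp iUY)
  (ellY : ObjectProperty (ConnectedPart (BTemp GY)))
  (toEllY : ConnectedPart (BTemp GY) ⥤ ellY.FullSubcategory) (adjY : toEllY ⊣ ellY.ι)
  (ellW : ObjectProperty (ConnectedPart (BTemp Γ)))
  (toEllW : ConnectedPart (BTemp Γ) ⥤ ellW.FullSubcategory) (adjW : toEllW ⊣ ellW.ι)
  {A B : ConnectedPart (BTemp Γ)} (α : A ⟶ B)
  (IsRationalα IsStrictlyRationalα : ((Example39Data.Dα α)ᵒᵖ ⥤ CommMonCat.{0}) → Prop)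

/-- **Example 3.9 (iv) «`Φ_α^ell` is cuspidally pure» (F-0615) HOLDS — no hypothesis beyond the construction data — at the Example 3.9 datum
over the GENUINE base `B^temp(Π)⁰` with (iii) := the rank-one engine of record** (`ofRankOneObjectConnectedPart P hpf R S Π` for ANY Def. 3.3
(iii) datum `dm` with a rank-one object `P`: abc-iut-L2-d2's Kummer–Tate tower at its base point, abc-iut-w6-d058's coset Tate tower, the
one-component model are instances), any admissible (i)-square of open continuous homomorphisms into `Π` and any (ii)-package: `hperf`, `hnd` by
the two theorems above, cuspidal purity of the engine by abc-iut-f-128's `isCuspidallyPure_ofRankOneObjectConnectedPart`.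
[cite: MochizukiEtTh2009, Ex 3.9 (iv) p.311 (PDF p.85); Def 3.6 (v) p.304 (PDF p.78)] -/
theorem example39_iv_cuspidallyPure_ofRankOneObjectConnectedPart :
    (Example39Data.ofInducedSquare iUX iUY iXW iYW hUX hUY hXW hYW cUX cUY cXW cYW hQX hQY hQW hsq treeMonoidVocabWeak.{0}
      ((RealifiedDivisorMonoids.ofRlfZWeak dm hpf).precomp (ofRankOneObjectConnectedPart P hpf R S Γ R' S').base) ellY toEllY adjY ellW
      toEllW adjW (ofRankOneObjectConnectedPart P hpf R S Γ R' S').Φ (isPerfect_Φ_ofRankOneObjectConnectedPart P hpf R S Γ R' S')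
      (ofRankOneObjectConnectedPart P hpf R S Γ R' S').isGroupSaturated (ofRankOneObjectConnectedPart P hpf R S Γ R' S').isPerfFactorial
      (isNonDilating_pull_ofRankOneObjectConnectedPart P hpf R S Γ R' S')).Example39_iv_cuspidallyPure α
      (Example39Data.frobenioidHyp_ofInducedSquare_ofTempered iUX iUY iXW iYW hUX hUY hXW hYW cUX cUY cXW cYW hQX hQY hQW hsq ellY
        toEllY adjY ellW toEllW adjW (ofRankOneObjectConnectedPart P hpf R S Γ R' S')
        (isPerfect_Φ_ofRankOneObjectConnectedPart P hpf R S Γ R' S') (isNonDilating_pull_ofRankOneObjectConnectedPart P hpf R S Γ R' S') α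
        IsRationalα IsStrictlyRationalα) :=
  Example39Data.example39_iv_cuspidallyPure_ofInducedSquare_ofTempered iUX iUY iXW iYW hUX hUY hXW hYW cUX cUY cXW cYW hQX hQY hQW hsq
    ellY toEllY adjY ellW toEllW adjW _ _ _ α IsRationalα IsStrictlyRationalα
    (isCuspidallyPure_ofRankOneObjectConnectedPart P hpf R S Γ R' S')

/-! ### §3. A CLOSED instance: the degenerate (i)-square `U = X = Y = W` over a tempered `Π`, (ii) read as `D^ell := D` -/

/-- **F-0615 INHABITED with every input supplied** (the only hypothesis is print's standing one, «`Π` tempered», [SemiAnbd] Def. 3.1 (i),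
giving open subgroups countable index, Rmk. 3.1.2): the Example 3.9 datum over `B^temp(Π)⁰` with the DEGENERATE (i)-square (all four groups
`Π`, all arrows the identity — honest: the text's bracketed instance `Ẋ → Ċ` is abc-iut-w6-d059's `nonempty_example39Data_dotC`, not this),
(ii) := `D^ell = D` (left adjoint from `ObjectProperty.topEquivalence`), (iii) := the rank-one engine's `Φ`; for EVERY arrow `α` of
`B^temp(Π)⁰`, «`Φ_α^ell` is cuspidally pure».  [cite: MochizukiEtTh2009, Ex 3.9 (iv) p.311 (PDF p.85); Def 3.6 (v) p.304 (PDF p.78)] -/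
theorem example39_iv_cuspidallyPure_ofRankOneObjectConnectedPart_idSquare (hG : IsTempered Γ) :
    (Example39Data.ofInducedSquare (MonoidHom.id Γ) (MonoidHom.id Γ) (MonoidHom.id Γ) (MonoidHom.id Γ) IsOpenMap.id IsOpenMap.id
      IsOpenMap.id IsOpenMap.id continuous_id continuous_id continuous_id continuous_id (fun V hV => hG.countable_quotient V hV)
      (fun V hV => hG.countable_quotient V hV) (fun V hV => hG.countable_quotient V hV) rfl treeMonoidVocabWeak.{0}
      ((RealifiedDivisorMonoids.ofRlfZWeak dm hpf).precomp (ofRankOneObjectConnectedPart P hpf R S Γ R' S').base)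
      ⊤ (ObjectProperty.topEquivalence _).inverse (ObjectProperty.topEquivalence _).symm.toAdjunction
      ⊤ (ObjectProperty.topEquivalence _).inverse (ObjectProperty.topEquivalence _).symm.toAdjunction
      (ofRankOneObjectConnectedPart P hpf R S Γ R' S').Φ (isPerfect_Φ_ofRankOneObjectConnectedPart P hpf R S Γ R' S')
      (ofRankOneObjectConnectedPart P hpf R S Γ R' S').isGroupSaturated (ofRankOneObjectConnectedPart P hpf R S Γ R' S').isPerfFactorial
      (isNonDilating_pull_ofRankOneObjectConnectedPart P hpf R S Γ R' S')).Example39_iv_cuspidallyPure α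
      (Example39Data.frobenioidHyp_ofInducedSquare_ofTempered (MonoidHom.id Γ) (MonoidHom.id Γ) (MonoidHom.id Γ) (MonoidHom.id Γ)
        IsOpenMap.id IsOpenMap.id IsOpenMap.id IsOpenMap.id continuous_id continuous_id continuous_id continuous_id
        (fun V hV => hG.countable_quotient V hV) (fun V hV => hG.countable_quotient V hV) (fun V hV => hG.countable_quotient V hV) rfl
        ⊤ (ObjectProperty.topEquivalence _).inverse (ObjectProperty.topEquivalence _).symm.toAdjunction
        ⊤ (ObjectProperty.topEquivalence _).inverse (ObjectProperty.topEquivalence _).symm.toAdjunction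
        (ofRankOneObjectConnectedPart P hpf R S Γ R' S') (isPerfect_Φ_ofRankOneObjectConnectedPart P hpf R S Γ R' S')
        (isNonDilating_pull_ofRankOneObjectConnectedPart P hpf R S Γ R' S') α IsRationalα IsStrictlyRationalα) :=
  example39_iv_cuspidallyPure_ofRankOneObjectConnectedPart P hpf R S Γ R' S' _ _ _ _ _ _ _ _ _ _ _ _ _ _ _ _ _ _ _ _ _ _ α
    IsRationalα IsStrictlyRationalα

end RankOneModel

end TemperedFrobenioid

end Literature.AnabelianGeometry.EtaleTheta

end
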